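import Summits.AtomisticToContinuum.Crystallization.Theorems.ExcessDecayLiouvilleGrainsGlue
import Summits.AtomisticToContinuum.Crystallization.Theorems.ExcessDecayLiouvilleLimitGlue
import Summits.AtomisticToContinuum.Crystallization.Theorems.HullMinimalityHullCriterionConverse
import Summits.AtomisticToContinuum.Crystallization.Theses.ChessboardParticlePlanes
import Summits.AtomisticToContinuum.Crystallization.Theses.LaminarSixThreeThree

/-!
# `PeriodicWindows` (stmt-AtomisticToContinuum-3240) from the three cruxes of route `ExcessDecayLiouville`

Crux-strategist s3 on item stmt-AtomisticToContinuum-3240 (decomposition census, heading `## Decomposition`):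
the ONLY typed split of `PeriodicWindows` into pieces that are not the crux reworded and whose joining
implication is derivable from LANDED glue is

  `PhononStability (stmt-9333) → HcpLiouville (stmt-9332) → CoarseGrains (stmt-9331) → PeriodicWindows`,

namely `grainsGlue_proof` (stmt-9336: the three cruxes give `FineGrains`), `limitGlue_proof` (stmt-9337:
`FineGrains → IsCrystallizing lennardJones 3`) and `hullCriterionConverse_proof` (stmt-11780:
`IsCrystallizing lennardJones 3 → PeriodicWindows`). This file records that implication for the three
byte-identical copies of the crux decl (routes `HullMinimality`, `ChessboardParticlePlanes`,
`LaminarSixThreeThree`), together with the one-piece form `FineGrains (stmt-9330) → PeriodicWindows`. (The certified equivalence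
`PeriodicWindows ↔ IsCrystallizing lennardJones 3` is `⟨PrestressSplitKorn.stub_hullCriterion,
hullCriterionConverse_proof⟩`, items stmt-3243 + stmt-11780: the crux is conjunct (ii) of the summit in hull
language.) No new mathematics: pure composition of landed theorems,
filed `--supports stmt-AtomisticToContinuum-3240` so that the dependency 3240 ⇐ 9331 ∧ 9332 ∧ 9333 is visible
in the tree (the pieces are the open, staffed cruxes of route `ExcessDecayLiouville`; no `route edit --split`
is filed on `HullMinimality`, where `closes` does not consume the `PeriodicWindows` binder).
-/

namespace Summit.AtomisticToContinuum.Crystallization.Theorems.PeriodicWindowsOfGrains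

open Summit.AtomisticToContinuum.Crystallization.Theses

/-- One-piece form: the target `FineGrains` (stmt-9330) of route `ExcessDecayLiouville` gives `PeriodicWindows`
(`limitGlue_proof` then `hullCriterionConverse_proof`). -/
theorem periodicWindows_of_fineGrains :
    ExcessDecayLiouville.FineGrains → HullMinimality.PeriodicWindows :=
  fun hFG => hullCriterionConverse_proof (limitGlue_proof hFG)

/-- The typed split: `PhononStability → HcpLiouville → CoarseGrains → PeriodicWindows`
(`grainsGlue_proof`, `limitGlue_proof`, `hullCriterionConverse_proof`). -/
theorem periodicWindows_of_grains :
    ExcessDecayLiouville.PhononStability → ExcessDecayLiouville.HcpLiouville →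
      ExcessDecayLiouville.CoarseGrains → HullMinimality.PeriodicWindows :=
  fun hPS hHL hCG => periodicWindows_of_fineGrains (grainsGlue_proof hPS hHL hCG)

/-- The same split concluding the `ChessboardParticlePlanes` copy of the crux decl (byte-identical body; the
registered skeleton's `crux_decl`). -/
theorem cppPeriodicWindows_of_grains :
    ExcessDecayLiouville.PhononStability → ExcessDecayLiouville.HcpLiouville →
      ExcessDecayLiouville.CoarseGrains → ChessboardParticlePlanes.PeriodicWindows :=
  fun hPS hHL hCG => periodicWindows_of_grains hPS hHL hCG

/-- The same split concluding the `LaminarSixThreeThree` copy of the crux decl (byte-identical body). -/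
theorem l633PeriodicWindows_of_grains :
    ExcessDecayLiouville.PhononStability → ExcessDecayLiouville.HcpLiouville →
      ExcessDecayLiouville.CoarseGrains → LaminarSixThreeThree.PeriodicWindows :=
  fun hPS hHL hCG => periodicWindows_of_grains hPS hHL hCG

end Summit.AtomisticToContinuum.Crystallization.Theorems.PeriodicWindowsOfGrains
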